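import Summits.ResolutionOfSingularities.ResolutionOfSingularities.Theorems.FrobeniusClosingSteerToricUnitExitFrame
import Literature.AlgebraicGeometry.Resolution.SymbolicPowersRsop
import HarnessLib

/-!
# Crux `Steer` (stmt-ResolutionOfSingularities-16345) — K-TX, part 4b: THE FRESH-UNIT LEMMA (case B of the toric tower): a unit letter
# `u = z_b/z_p` born from two regular parameters of equal value is «square-free to first order»: `u·W − h² ∉ 𝔪²` for every `h`

OURS (campaign res-hironaka, rung L ★L-G4, slot W4.1; res-D-brk-2 g6, K-TX part 4 per own design note D/res-D-brk-2/HANDOFF.md §gen 6).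
Candidates, not facts; NOT a statement of H. Hironaka's manuscript [claim: Hironaka2017, status: under-review]; AI formalisation, weaker than
expert review; `--supports stmt-ResolutionOfSingularities-16345`, counted 0. Definition-free.

## What is proved (characteristic 2)

* `sq_free_polynomial` (`§1`, pure algebra over a field `κ` of characteristic `2`): for a prime ideal `𝔭` of `κ[X]`, `D, S ∉ 𝔭`, `a ≠ 0`:
  `D·(S²·a·X − Γ²) ∉ 𝔭²` — `X` is a SIMPLE root direction: in characteristic 2 the derivative of `S²aX − Γ²` is `S²a`.
* `exists_num_den_of_mem_sq` (`§2`): an element of `(𝔪_{B_𝔮})²` is `num/den` with `num ∈ 𝔮²`, `den ∉ 𝔮` (`𝔮` the centre of `O` on `B`).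
* **`fresh_unit_sub_sq_not_mem_sq`** (`§3`): `R₀ ⊆ O` regular local dominated by `O`, `(z_p, z_b)` part of a regular system of parameters with
  `v(z_b) ≤ v(z_p) < 1`, `C = R₀[z_p/z_p, z_b/z_p]`, `R♯ = C_{𝔪_O ∩ C}`, `u = z_b/z_p`; for `w ∈ R₀ˣ`, `W ∈ C` with `W − w ∈ 𝔪₀C` and `h ∈ R♯`:
  `u·W − h² ∉ (𝔪_{R♯})²`. Proof: the chart map `φ : C ↠ κ₀[X]` (`C/(z_p) ≅ (R₀/(z_p,z_b))[X]`, tree `ChartRsop.closure_chartQuotient_X`, then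
  coefficients mod `𝔪₀`), `φ(u) = X`, `φ|_{R₀} =` residues, `ker φ = 𝔪₀C ⊆ 𝔮`; `𝔭 := φ(𝔮)`; clearing denominators turns `uW − h² ∈ 𝔪♯²`
  into `D·(S²·w̄·X − Γ²) ∈ 𝔭²`, excluded by `§1`.
[cite: Matsumura1987, Thm. 14.2] [cite: DeJong1996, 2.4] [cite: StacksProject, Tag 0BIQ] [folklore]
-/

noncomputable section

-- single-problem summit: the doubled namespace component `ResolutionOfSingularities` is forced
set_option linter.dupNamespace false

open scoped BigOperators

namespace Summit.ResolutionOfSingularities.ResolutionOfSingularities.Theorems.SteerToricUnitExit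

open Polynomial IsLocalRing
open Literature.AlgebraicGeometry.Resolution
open Summit.ResolutionOfSingularities.ResolutionOfSingularities.Theorems.SwitchingDichotomy

/-! ## §1 The polynomial lemma: `X` is a simple-root direction in characteristic 2 -/

section Poly

variable {κ : Type} [Field κ]

/-- In characteristic `2` the derivative of `S²·(a·X) − Γ²` is `S²·a`. [folklore] -/
theorem derivative_sq_mul_sub_sq (h2 : (2 : κ) = 0) (S Γ : κ[X]) (a : κ) :
    derivative (S ^ 2 * (C a * X) - Γ ^ 2) = S ^ 2 * C a := by
  have hC2 : (C (2 : κ) : κ[X]) = 0 := by rw [h2, map_zero]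
  simp only [derivative_sub, derivative_mul, derivative_pow, derivative_C, derivative_X, Nat.cast_ofNat, hC2, zero_mul,
    zero_add, sub_zero, mul_one]

/-- If `P²` divides `Φ` then `P` divides `Φ'` (characteristic 2: `(P²G)' = P²G'`). [folklore] -/
theorem dvd_derivative_of_sq_dvd (h2 : (2 : κ) = 0) {P Φ : κ[X]} (h : P ^ 2 ∣ Φ) : P ∣ derivative Φ := by
  obtain ⟨G, rfl⟩ := h
  have hC2 : (C (2 : κ) : κ[X]) = 0 := by rw [h2, map_zero]
  refine ⟨P * derivative G, ?_⟩
  simp only [derivative_mul, derivative_pow, Nat.cast_ofNat, hC2, zero_mul, zero_add]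
  ring

/-- **`X` is a simple-root direction**: for a prime ideal `𝔭` of `κ[X]` (`char κ = 2`), `D, S ∉ 𝔭` and `a ≠ 0`, the element
`D·(S²·a·X − Γ²)` does NOT lie in `𝔭²`. (`𝔭 = (P)`: `P² ∣ S²aX − Γ²` forces `P ∣ (S²aX − Γ²)' = S²a`, so `P ∣ S`; `𝔭 = 0`: degrees.)
[folklore] -/
theorem sq_free_polynomial (h2 : (2 : κ) = 0) (𝔭 : Ideal κ[X]) [h𝔭 : 𝔭.IsPrime] (D S Γ : κ[X]) (a : κ) (ha : a ≠ 0)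
    (hD : D ∉ 𝔭) (hS : S ∉ 𝔭) : D * (S ^ 2 * (C a * X) - Γ ^ 2) ∉ 𝔭 ^ 2 := by
  classical
  set Φ := S ^ 2 * (C a * X) - Γ ^ 2 with hΦ
  obtain ⟨P, hP⟩ := (IsPrincipalIdealRing.principal 𝔭).principal
  have hP' : 𝔭 = Ideal.span {P} := hP
  intro hmem
  rw [hP', Ideal.span_singleton_pow, Ideal.mem_span_singleton] at hmem
  rw [hP', Ideal.mem_span_singleton] at hD hS
  have hS0 : S ≠ 0 := fun h => hS (h ▸ dvd_zero P)
  have hD0 : D ≠ 0 := fun h => hD (h ▸ dvd_zero P)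
  by_cases hP0 : P = 0
  · -- `𝔭 = 0`: `D·Φ = 0`, so `S²aX = Γ²` — odd degree vs even degree
    rw [hP0, zero_pow two_ne_zero, zero_dvd_iff, mul_eq_zero] at hmem
    rcases hmem with h | h
    · exact hD0 h
    have heq : S ^ 2 * (C a * X) = Γ ^ 2 := sub_eq_zero.mp h
    have hdeg : (S ^ 2 * (C a * X)).natDegree = 2 * S.natDegree + 1 := by
      rw [natDegree_mul (pow_ne_zero 2 hS0) (mul_ne_zero (by simpa using ha) X_ne_zero), natDegree_pow,
        natDegree_C_mul_X a ha]
    have hdeg' : (Γ ^ 2).natDegree = 2 * Γ.natDegree := by rw [natDegree_pow]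
    have hcontra : 2 * S.natDegree + 1 = 2 * Γ.natDegree := by rw [← hdeg, ← hdeg', heq]
    omega
  · -- `𝔭 = (P)`, `P` prime
    have hPprime : Prime P := (Ideal.span_singleton_prime hP0).mp (hP' ▸ h𝔭)
    -- `P² ∣ D·Φ`, `P ∤ D` ⇒ `P² ∣ Φ`
    have h1 : P ∣ Φ := by
      have := (dvd_trans (dvd_pow_self P two_ne_zero) hmem)
      exact (hPprime.dvd_or_dvd this).resolve_left hD
    obtain ⟨Φ₁, hΦ₁⟩ := h1
    have h2P : P ^ 2 ∣ Φ := by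
      rw [hΦ₁] at hmem ⊢
      have : P * P ∣ P * (D * Φ₁) := by
        have e : D * (P * Φ₁) = P * (D * Φ₁) := by ring
        rw [← e, ← pow_two]; exact hmem
      have h3 : P ∣ D * Φ₁ := (mul_dvd_mul_iff_left hP0).mp this
      have h4 : P ∣ Φ₁ := (hPprime.dvd_or_dvd h3).resolve_left hD
      rw [pow_two]; exact mul_dvd_mul_left P h4
    -- derivative: `P ∣ Φ' = S²a` ⇒ `P ∣ S`
    have hder : P ∣ S ^ 2 * C a := by
      have := dvd_derivative_of_sq_dvd h2 h2P
      rwa [hΦ, derivative_sq_mul_sub_sq h2] at this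
    have hCa : ¬ P ∣ C a := fun h => by
      have hu : IsUnit (C a) := isUnit_C.mpr (Ne.isUnit ha)
      exact hPprime.not_unit (isUnit_of_dvd_unit h hu)
    have : P ∣ S ^ 2 := (hPprime.dvd_or_dvd hder).resolve_right hCa
    exact hS (hPprime.dvd_of_dvd_pow this)

end Poly

/-! ## §2 Squares of the maximal ideal of a local ring at the centre -/

section Centre

variable {K : Type} [Field K]

/-- An element of `(𝔪_{B_𝔮})²` (`B ⊆ O`, `𝔮` the centre of `O` on `B`) is a fraction `num/den` with `num ∈ 𝔮²` and `den ∈ B ∖ 𝔮`.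
[cite: NovacoskiSpivakovsky2014, Def. 2.8] [folklore] -/
theorem exists_num_den_of_mem_sq {B : Subring K} {O : ValuationSubring K} (hBO : B ≤ O.toSubring)
    (x : locAtCentre B O)
    (hx : (haveI := isLocalRing_locAtCentre hBO; x ∈ maximalIdeal (locAtCentre B O) ^ 2)) :
    ∃ num : B, num ∈ subringCentre B O hBO ^ 2 ∧ ∃ den : B, den ∉ subringCentre B O hBO ∧ (x : K) = num / den := by
  haveI := isLocalRing_locAtCentre hBO
  -- the property is stable under `+` and holds for products of two elements of `𝔪`
  have key : ∀ y ∈ maximalIdeal (locAtCentre B O) * maximalIdeal (locAtCentre B O),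
      ∃ num : B, num ∈ subringCentre B O hBO ^ 2 ∧ ∃ den : B, den ∉ subringCentre B O hBO ∧ (y : K) = num / den := by
    intro y hy
    refine Submodule.mul_induction_on hy ?_ ?_
    · intro a ha b hb
      obtain ⟨a₁, ha₁, s₁, hs₁, hv₁, hae⟩ := a.2
      obtain ⟨b₁, hb₁, s₂, hs₂, hv₂, hbe⟩ := b.2
      have hva : O.valuation (a : K) < 1 := (mem_maximalIdeal_locAtCentre_iff hBO a).mp ha
      have hvb : O.valuation (b : K) < 1 := (mem_maximalIdeal_locAtCentre_iff hBO b).mp hb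
      have hva₁ : O.valuation a₁ < 1 := by rw [hae, map_div₀, hv₁, div_one] at hva; exact hva
      have hvb₁ : O.valuation b₁ < 1 := by rw [hbe, map_div₀, hv₂, div_one] at hvb; exact hvb
      refine ⟨⟨a₁ * b₁, B.mul_mem ha₁ hb₁⟩, ?_, ⟨s₁ * s₂, B.mul_mem hs₁ hs₂⟩, ?_, ?_⟩
      · rw [pow_two]
        exact Ideal.mul_mem_mul ((mem_subringCentre_iff hBO ⟨a₁, ha₁⟩).mpr hva₁) ((mem_subringCentre_iff hBO ⟨b₁, hb₁⟩).mpr hvb₁)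
      · rw [mem_subringCentre_iff]
        change ¬ O.valuation (s₁ * s₂) < 1
        rw [Valuation.map_mul, hv₁, hv₂, one_mul]; exact lt_irrefl _
      · change (a : K) * b = a₁ * b₁ / (s₁ * s₂)
        rw [hae, hbe]; field_simp
    · intro a b ⟨n₁, hn₁, d₁, hd₁, he₁⟩ ⟨n₂, hn₂, d₂, hd₂, he₂⟩
      have hvd₁ := valuation_eq_one_of_not_mem_subringCentre hBO hd₁
      have hvd₂ := valuation_eq_one_of_not_mem_subringCentre hBO hd₂
      refine ⟨n₁ * d₂ + n₂ * d₁, Ideal.add_mem _ (Ideal.mul_mem_right _ _ hn₁) (Ideal.mul_mem_right _ _ hn₂), d₁ * d₂, ?_, ?_⟩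
      · rw [mem_subringCentre_iff]
        change ¬ O.valuation ((d₁ : K) * d₂) < 1
        rw [Valuation.map_mul, hvd₁, hvd₂, one_mul]; exact lt_irrefl _
      · change (a : K) + b = ((n₁ : K) * d₂ + n₂ * d₁) / (d₁ * d₂)
        have h1 := ne_zero_of_valuation_eq_one hvd₁
        have h2 := ne_zero_of_valuation_eq_one hvd₂
        rw [he₁, he₂]; field_simp
  rw [pow_two] at hx
  exact key x hx

end Centre

/-! ## §3 The fresh-unit lemma -/

section Fresh

variable {K : Type} [Field K]

/-- **THE FRESH-UNIT LEMMA** (case B of the toric tower, characteristic 2). `R₀ ⊆ O` regular local dominated by `O`;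
`c = (z_p, z_b)` part of a regular system of parameters with `v(z_b) ≤ v(z_p)`; `C = R₀[z_j/z_p]`, `R♯ = C_{𝔪_O ∩ C}`, `u = z_b/z_p`.
For a unit `w` of `R₀`, `W ∈ C` with `W − w ∈ 𝔪₀·C`, and `h ∈ R♯`: `u·W − h² ∉ (𝔪_{R♯})²` — the unit letter born from two parameters is
square-free to first order, because under the chart map `C ↠ κ₀[X]` (`u ↦ X`) the element becomes `D·(S²·w̄·X − Γ²)` with `D, S` off
the image prime, excluded by `sq_free_polynomial`. OURS. [cite: DeJong1996, 2.4] [cite: StacksProject, Tag 0BIQ]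
[cite: Matsumura1987, Thm. 14.2] [folklore] -/
theorem fresh_unit_sub_sq_not_mem_sq [CharP K 2] (O : ValuationSubring K) (R₀ : Subring K) [IsRegularLocalRing R₀]
    (hRO : R₀ ≤ O.toSubring) (hcen : ∀ a : R₀, a ∈ maximalIdeal R₀ ↔ O.valuation (a : K) < 1)
    (c : Fin 2 → R₀) (hc : IsRsopPart c) (hmax : ∀ j, O.valuation ((c j : R₀) : K) ≤ O.valuation ((c 0 : R₀) : K))
    (w : R₀) (hw : IsUnit w) (W : K)
    (hWC : W ∈ Subring.closure ((R₀ : Set K) ∪ Set.range fun j => ((c j : R₀) : K) / ((c 0 : R₀) : K)))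
    (hWw : (⟨W, hWC⟩ : Subring.closure ((R₀ : Set K) ∪ Set.range fun j => ((c j : R₀) : K) / ((c 0 : R₀) : K))) -
        Subring.inclusion (ChartRsop.le_closure_chart R₀ c 0) w ∈
      Ideal.map (Subring.inclusion (ChartRsop.le_closure_chart R₀ c 0)) (maximalIdeal R₀))
    (h : K) (hh : h ∈ locAtCentre (Subring.closure ((R₀ : Set K) ∪ Set.range fun j => ((c j : R₀) : K) / ((c 0 : R₀) : K))) O)
    (hx : ((c 1 : R₀) : K) / ((c 0 : R₀) : K) * W - h ^ 2 ∈
      locAtCentre (Subring.closure ((R₀ : Set K) ∪ Set.range fun j => ((c j : R₀) : K) / ((c 0 : R₀) : K))) O) :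
    (haveI := isLocalRing_locAtCentre (ChartRsop.closure_chart_le hRO c 0 (hc.ne_zero 0) hmax);
      (⟨((c 1 : R₀) : K) / ((c 0 : R₀) : K) * W - h ^ 2, hx⟩ :
          locAtCentre (Subring.closure ((R₀ : Set K) ∪ Set.range fun j => ((c j : R₀) : K) / ((c 0 : R₀) : K))) O) ∉
        maximalIdeal (locAtCentre (Subring.closure ((R₀ : Set K) ∪ Set.range fun j => ((c j : R₀) : K) / ((c 0 : R₀) : K))) O) ^ 2) := by
  classical
  set C' : Subring K := Subring.closure ((R₀ : Set K) ∪ Set.range fun j => ((c j : R₀) : K) / ((c 0 : R₀) : K)) with hC'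
  have hci : c 0 ≠ 0 := hc.ne_zero 0
  have h0 : ((c 0 : R₀) : K) ≠ 0 := fun e => hci (Subtype.ext e)
  have hCO : C' ≤ O.toSubring := ChartRsop.closure_chart_le hRO c 0 hci hmax
  have hRC : R₀ ≤ C' := ChartRsop.le_closure_chart R₀ c 0
  haveI : IsLocalRing (locAtCentre C' O) := isLocalRing_locAtCentre hCO
  set u : K := ((c 1 : R₀) : K) / ((c 0 : R₀) : K) with hu
  have huC : u ∈ C' := ChartRsop.div_mem_closure_chart R₀ c 0 1
  -- the quotient ring of the chart: `C/(z_p) ≅ (R₀/(z_p,z_b))[σ]`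
  obtain ⟨e, x, hd, hxspan, hxc⟩ := hc.exists_rsop
  have hqr : IsQuasiRegular c := by
    have h1 := isQuasiRegular_rsop_comp hd x hxspan (Fin.castAdd e) (Fin.castAdd_injective _ _)
    have e1 : x ∘ Fin.castAdd e = c := funext hxc
    rwa [e1] at h1
  set I : Ideal R₀ := Ideal.span (Set.range c) with hI
  have hIle : I ≤ maximalIdeal R₀ := hc.span_range_le_maximalIdeal
  letI : Unique {j : Fin 2 // j ≠ (0 : Fin 2)} :=
    { default := ⟨1, one_ne_zero⟩
      uniq := fun j => by
        obtain ⟨j, hj⟩ := j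
        apply Subtype.ext
        fin_cases j
        · exact absurd rfl hj
        · rfl }
  set κ₀ := R₀ ⧸ maximalIdeal R₀ with hκ₀
  haveI : Fact (maximalIdeal R₀).IsMaximal := ⟨IsLocalRing.maximalIdeal.isMaximal R₀⟩
  letI : Field κ₀ := Ideal.Quotient.field (maximalIdeal R₀)
  set zp' : C' := ⟨((c 0 : R₀) : K), hRC (c 0).2⟩ with hzp'
  set J : Ideal C' := Ideal.span {zp'} with hJ
  obtain ⟨ψ, hψ, hψC, hψX⟩ := ChartRsop.closure_chartQuotient_X R₀ c hqr 0 hci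
  set eψ := RingEquiv.ofBijective ψ hψ with heψ
  set red : MvPolynomial {j : Fin 2 // j ≠ (0 : Fin 2)} (R₀ ⧸ I) →+* MvPolynomial {j : Fin 2 // j ≠ (0 : Fin 2)} κ₀ :=
    MvPolynomial.map (Ideal.Quotient.factor hIle) with hred
  set toP := (MvPolynomial.uniqueAlgEquiv κ₀ {j : Fin 2 // j ≠ (0 : Fin 2)}).toRingEquiv.toRingHom with htoP
  set φ : C' →+* κ₀[X] := toP.comp (red.comp (eψ.symm.toRingHom.comp (Ideal.Quotient.mk J))) with hφ
  -- values of `φ`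
  have hφR : ∀ r : R₀, φ (Subring.inclusion hRC r) = Polynomial.C (Ideal.Quotient.mk (maximalIdeal R₀) r) := by
    intro r
    have e1 : eψ.symm (Ideal.Quotient.mk J (Subring.inclusion hRC r)) = MvPolynomial.C (Ideal.Quotient.mk I r) := by
      rw [RingEquiv.symm_apply_eq]
      exact (hψC r).symm
    simp only [hφ, RingHom.comp_apply, RingEquiv.toRingHom_eq_coe, RingEquiv.coe_toRingHom]
    rw [e1, hred, MvPolynomial.map_C, Ideal.Quotient.factor_mk, htoP]
    change MvPolynomial.uniqueAlgEquiv κ₀ _ (MvPolynomial.C _) = _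
    rw [← MvPolynomial.monomial_zero', MvPolynomial.uniqueAlgEquiv_monomial, Finsupp.zero_apply, Polynomial.monomial_zero_left]
  have hφu : φ ⟨u, huC⟩ = Polynomial.X := by
    have e1 : eψ.symm (Ideal.Quotient.mk J ⟨u, huC⟩) = MvPolynomial.X ⟨1, one_ne_zero⟩ := by
      rw [RingEquiv.symm_apply_eq]
      exact (hψX ⟨1, one_ne_zero⟩).symm
    simp only [hφ, RingHom.comp_apply, RingEquiv.toRingHom_eq_coe, RingEquiv.coe_toRingHom]
    rw [e1, hred, MvPolynomial.map_X, htoP]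
    change MvPolynomial.uniqueAlgEquiv κ₀ _ (MvPolynomial.X _) = _
    rw [MvPolynomial.X, MvPolynomial.uniqueAlgEquiv_monomial]
    have e2 : (Finsupp.single (⟨1, one_ne_zero⟩ : {j : Fin 2 // j ≠ (0 : Fin 2)}) 1) default = 1 :=
      Finsupp.single_eq_same
    rw [e2, Polynomial.monomial_one_one_eq_X]
  -- `φ` is surjective
  have hφsurj : Function.Surjective φ := by
    rw [hφ]
    refine (MvPolynomial.uniqueAlgEquiv κ₀ _).toRingEquiv.surjective.comp ?_
    refine (MvPolynomial.map_surjective _ ?_).comp (eψ.symm.surjective.comp Ideal.Quotient.mk_surjective)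
    exact Ideal.Quotient.factor_surjective hIle
  -- `𝔪₀·C ≤ ker φ ≤ 𝔮`
  set 𝔮 : Ideal C' := subringCentre C' O hCO with h𝔮
  have hM0ker : Ideal.map (Subring.inclusion hRC) (maximalIdeal R₀) ≤ RingHom.ker φ := by
    rw [Ideal.map_le_iff_le_comap]
    intro r hr
    rw [Ideal.mem_comap, RingHom.mem_ker, hφR, Ideal.Quotient.eq_zero_iff_mem.mpr hr, map_zero]
  have hkerφ : RingHom.ker φ ≤ 𝔮 := by
    intro y hy
    rw [RingHom.mem_ker] at hy
    -- `red (eψ.symm (mk y)) = 0`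
    have h1 : red (eψ.symm (Ideal.Quotient.mk J y)) = 0 := by
      have : toP (red (eψ.symm (Ideal.Quotient.mk J y))) = 0 := by simpa [hφ] using hy
      exact (MvPolynomial.uniqueAlgEquiv κ₀ _).toRingEquiv.injective (by simpa [htoP] using this)
    have h2 : eψ.symm (Ideal.Quotient.mk J y) ∈ Ideal.map MvPolynomial.C (RingHom.ker (Ideal.Quotient.factor hIle)) := by
      rw [← MvPolynomial.ker_map]; exact h1
    have hkerfac : RingHom.ker (Ideal.Quotient.factor hIle) = Ideal.map (Ideal.Quotient.mk I) (maximalIdeal R₀) := by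
      ext q
      obtain ⟨r, rfl⟩ := Ideal.Quotient.mk_surjective q
      rw [RingHom.mem_ker, Ideal.Quotient.factor_mk, Ideal.Quotient.eq_zero_iff_mem,
        Ideal.mem_map_iff_of_surjective _ Ideal.Quotient.mk_surjective]
      constructor
      · intro hr; exact ⟨r, hr, rfl⟩
      · rintro ⟨r', hr', he⟩
        rw [Ideal.Quotient.eq] at he
        have : r' - (r' - r) ∈ maximalIdeal R₀ := Ideal.sub_mem _ hr' (hIle he)
        simpa using this
    rw [hkerfac, Ideal.map_map] at h2
    -- push through `eψ`: `mk y ∈ map (eψ ∘ C ∘ mk I) 𝔪₀ = map (mk J ∘ incl) 𝔪₀`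
    have h3 : Ideal.Quotient.mk J y ∈ Ideal.map (eψ.toRingHom.comp (MvPolynomial.C.comp (Ideal.Quotient.mk I))) (maximalIdeal R₀) := by
      rw [← Ideal.map_map]
      have := Ideal.mem_map_of_mem eψ.toRingHom h2
      simpa using this
    have hcomp : eψ.toRingHom.comp (MvPolynomial.C.comp (Ideal.Quotient.mk I)) =
        (Ideal.Quotient.mk J).comp (Subring.inclusion hRC) := by
      ext r
      simp only [RingHom.comp_apply, RingEquiv.toRingHom_eq_coe, RingEquiv.coe_toRingHom, heψ, RingEquiv.ofBijective_apply]
      exact hψC r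
    rw [hcomp, ← Ideal.map_map] at h3
    have h4 : y ∈ Ideal.comap (Ideal.Quotient.mk J) (Ideal.map (Ideal.Quotient.mk J)
        (Ideal.map (Subring.inclusion hRC) (maximalIdeal R₀))) := h3
    rw [Ideal.comap_map_of_surjective _ Ideal.Quotient.mk_surjective, ← RingHom.ker_eq_comap_bot, Ideal.mk_ker] at h4
    -- both pieces lie in the centre
    have hM0𝔮 : Ideal.map (Subring.inclusion hRC) (maximalIdeal R₀) ≤ 𝔮 := by
      rw [Ideal.map_le_iff_le_comap]
      intro r hr
      rw [Ideal.mem_comap, h𝔮, mem_subringCentre_iff]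
      exact (hcen r).mp hr
    have hJ𝔮 : J ≤ 𝔮 := by
      rw [hJ, Ideal.span_le, Set.singleton_subset_iff, SetLike.mem_coe, h𝔮, mem_subringCentre_iff]
      exact (hcen (c 0)).mp (hc.mem_maximalIdeal 0)
    rcases Submodule.mem_sup.mp h4 with ⟨y₁, hy₁, y₂, hy₂, rfl⟩
    exact Ideal.add_mem _ (hM0𝔮 hy₁) (hJ𝔮 hy₂)
  -- the prime `𝔭 = φ(𝔮)` of `κ₀[X]`
  set 𝔭 : Ideal κ₀[X] := Ideal.map φ 𝔮 with h𝔭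
  haveI h𝔭p : 𝔭.IsPrime := Ideal.map_isPrime_of_surjective hφsurj hkerφ
  have hcomap : Ideal.comap φ 𝔭 = 𝔮 := by
    rw [h𝔭, Ideal.comap_map_of_surjective _ hφsurj, ← RingHom.ker_eq_comap_bot, sup_eq_left.mpr hkerφ]
  have hoff : ∀ q : C', q ∉ 𝔮 → φ q ∉ 𝔭 := fun q hq hmem => hq (by rw [← hcomap]; exact hmem)
  -- the assumed membership, cleared of denominators
  intro hsq
  obtain ⟨hn, hhn, hs, hhs, hvs, hheq⟩ := hh
  obtain ⟨num, hnum, den, hden, hxeq⟩ := exists_num_den_of_mem_sq hCO _ hsq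
  have hvden := valuation_eq_one_of_not_mem_subringCentre hCO hden
  have hs0 : hs ≠ 0 := ne_zero_of_valuation_eq_one hvs
  have hden0 : (den : K) ≠ 0 := ne_zero_of_valuation_eq_one hvden
  set hs' : C' := ⟨hs, hhs⟩ with hhs'
  set hn' : C' := ⟨hn, hhn⟩ with hhn'
  set W' : C' := ⟨W, hWC⟩ with hW'
  set u' : C' := ⟨u, huC⟩ with hu'
  have hxeq' : u * W - h ^ 2 = num / den := hxeq
  have hidK : (den : K) * hs ^ 2 * u * W - den * hn ^ 2 = num * hs ^ 2 := by
    rw [hheq, div_pow] at hxeq'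
    have e2 : u * W = num / den + hn ^ 2 / hs ^ 2 := by rw [← hxeq']; ring
    calc (den : K) * hs ^ 2 * u * W - den * hn ^ 2 = den * hs ^ 2 * (u * W) - den * hn ^ 2 := by ring
      _ = den * hs ^ 2 * (num / den + hn ^ 2 / hs ^ 2) - den * hn ^ 2 := by rw [e2]
      _ = num * hs ^ 2 := by field_simp; ring
  have hidC : den * hs' ^ 2 * u' * W' - den * hn' ^ 2 = num * hs' ^ 2 := Subtype.ext (by
    simp only [hhs', hhn', hW', hu']
    push_cast
    linear_combination hidK)
  have hmem2 : den * hs' ^ 2 * u' * W' - den * hn' ^ 2 ∈ 𝔮 ^ 2 := by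
    rw [hidC]; exact Ideal.mul_mem_right _ _ hnum
  -- apply `φ`
  have hφW : φ W' = Polynomial.C (Ideal.Quotient.mk (maximalIdeal R₀) w) := by
    have e : W' = Subring.inclusion hRC w + (W' - Subring.inclusion hRC w) := by ring
    rw [e, map_add, hφR, (RingHom.mem_ker).mp (hM0ker hWw), add_zero]
  have himg : φ (den * hs' ^ 2 * u' * W' - den * hn' ^ 2) =
      φ den * ((φ hs') ^ 2 * (Polynomial.C (Ideal.Quotient.mk (maximalIdeal R₀) w) * Polynomial.X) - (φ hn') ^ 2) := by
    simp only [map_sub, map_mul, map_pow, hφu, hφW]; ring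
  have hmemP : φ den * ((φ hs') ^ 2 * (Polynomial.C (Ideal.Quotient.mk (maximalIdeal R₀) w) * Polynomial.X) - (φ hn') ^ 2) ∈
      𝔭 ^ 2 := by
    rw [← himg, h𝔭, ← Ideal.map_pow]
    exact Ideal.mem_map_of_mem φ hmem2
  -- characteristic 2 in the residue field, `w̄ ≠ 0`
  have h2R : (2 : R₀) = 0 := by
    apply Subtype.ext
    have h := CharP.cast_eq_zero K 2
    push_cast at h ⊢
    exact h
  have h2 : (2 : κ₀) = 0 := by
    rw [show (2 : κ₀) = Ideal.Quotient.mk (maximalIdeal R₀) 2 from (map_ofNat _ 2).symm, h2R, map_zero]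
  have ha : Ideal.Quotient.mk (maximalIdeal R₀) w ≠ 0 := by
    rw [Ne, Ideal.Quotient.eq_zero_iff_mem]
    exact fun hm => (IsLocalRing.mem_maximalIdeal _).mp hm hw
  have hsoff : hs' ∉ 𝔮 := by
    rw [h𝔮, mem_subringCentre_iff]
    change ¬ O.valuation hs < 1
    rw [hvs]; exact lt_irrefl _
  exact sq_free_polynomial h2 𝔭 (φ den) (φ hs') (φ hn') _ ha (hoff den hden) (hoff hs' hsoff) hmemP

end Fresh

end Summit.ResolutionOfSingularities.ResolutionOfSingularities.Theorems.SteerToricUnitExit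

end
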